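import Summits.BirchSwinnertonDyer.BirchSwinnertonDyer.Theorems.EdixhovenFibreFiveSevenTwistDegreeStepFiveSevenOffKPOfReciprocityLaw
import Literature.NumberTheory.PAdicHodge.DeRhamSupersingularRamifiedCells
import HarnessLib

/-!
# Crux TDS57 `TwistDegreeStepFiveSeven` (stmt-BirchSwinnertonDyer-22227): the potentially supersingular cell `(5; IV)` — de Rham
# input DISCHARGED by the explicit model over `ℚ₅(5^{1/3})`; the step at `p = 5` off the KP sub-residue on types III, IV

Cell `pub/bsd-wall`, seat `bsd-line-edix-p1` g18 (LEAD of line `kato_lever`; `--supports` 22227 as a helper). TOOL theorems only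
(no definition, no named fact, no `sorry`); nothing is closed; BSD is not proved by any of this.

WHAT. Sequel of `…TwistDegreeStepFiveSevenOffKPOfReciprocityLaw` (p = 7 cells, (5; III)). Here the cell `(5; IV)` (`ord₅ Δ_min = 4`,
`ord₅ c₄ ≥ 2`): over `K' = ℚ(5^{1/3})` the curve acquires good SUPERSINGULAR reduction with the explicit model `y² = x³ + a ϱ² x + b`
(`ϱ³ = 5`), cell data `(e, k, m, n, r₄, r₆, t₄, t₆) = (3, 1, 2, 2, 2, 0, 2, 0)` — NOT one of the three enumerated K★ cells of the original
capstone, but within reach of its (N1′) inequality `e < r₄ + (p − 1)` (`3 < 6`): the inequality-form capstone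
`isDeRham_restrictedRationalTateRep_of_explicitModel_of_lt` (`Literature/NumberTheory/PAdicHodge/DeRhamSupersingularRamifiedCells.lean`).

* `isDeRham_adicCompletion_rat_of_model_of_lt` — the bridge `isDeRham_adicCompletion_rat_of_model_of_explicitCapstone` (explicit `K'`-model
  `S ≅ W ×_ℚ K'`, unit numerology `unit_identity`, descent `ℚ_v ← K'_{v'}`) VERBATIM, fed with the inequality-form capstone instead of
  the enumerated `hR'`;
* ★ `isDeRham_adicCompletion_rat_five_of_padicValInt_eq_four` — `V_pV|_{Γ_{ℚ_v}}` is de Rham for every globally minimal `V/ℚ` additive at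
  `5` with no `Iₙ*` fibre and `ord₅ Δ_min = 4` (Kodaira type IV);
* ★★ `twistDegreeStep57_of_sl2NeronValuesBar_five_of_padicValInt_eq_four` — the conclusion of TDS57 at `(5, V, W♭)` on the cell `(5; IV)`
  GRANTED {P1-bar, hT₂, modularity, Dokchitser–Dokchitser 5.1 (1)} (off-KP is a theorem on type IV:
  `forall_member_noTorsion_of_kodaira_IV_or_III_at_seven`); `…_of_reciprocityLaw_…` with [REC-tower] in place of hT₂;
* `twistDegreeStep57_of_sl2NeronValuesBar_of_noTorsion_five_of_three_le` — at `p = 5`, `ord₅ Δ_min ∈ {3, 4}`, off the KP sub-residue,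
  GRANTED {P1-bar, hT₂, modularity}: no de Rham hypothesis.
After this file the only cell of TDS57 with a de Rham HYPOTHESIS is `(5; II)` (`e = 6 = r₄ + (p − 1)`, the canonical-subgroup regime
of (N1′); Fontaine's general theorem `isDeRham_restrictedRationalTateRep` remains the cite there). CONDITIONAL; the item stays OPEN.

References: [Kato2004Asterisque] (8.1.3) p. 180, Thm. 9.7 p. 189; [Kato1993LNM1553] Ch. II Thm. 1.4.1 (4), Ex. 1.3.5; [KostersPannekoek2017]
Thm. 1, Cor. 2; [DokchitserDokchitser2015LocalInvariants] Thm. 3.2, 5.1 (1); [Fontaine1982FormesDifferentielles] §5; [SilvermanAEC2009]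
VII.5.5, IV.7.5; [BrinonConrad2009] Prop. 6.3.8.
-/

set_option autoImplicit false
-- the Theorems namespace of a single-conjunct summit repeats the summit name by design (D-0017)
set_option linter.dupNamespace false

noncomputable section

open scoped Classical MatrixGroups NumberField

open Polynomial WeierstrassCurve NumberField IsDedekindDomain Field ValuativeRel
  Literature.NumberTheory.EllipticCurves Literature.NumberTheory.EllipticCurves.ModularForms
  Literature.NumberTheory.EllipticCurves.Rank1Residual Literature.NumberTheory.EllipticCurves.Kato2004
  Literature.NumberTheory.DiophantineGeometry Rat.HeightOneSpectrum
  Literature.NumberTheory.PAdicHodge Literature.NumberTheory.GaloisRepresentations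
  Literature.NumberTheory.GaloisRepresentations.IsNonarchimedeanLocalField
  Summit.BirchSwinnertonDyer.Rank1Residual Summit.BirchSwinnertonDyer.Rank1Residual.Additive
  Summit.BirchSwinnertonDyer.BirchSwinnertonDyer.Theorems
  Summit.BirchSwinnertonDyer.BirchSwinnertonDyer.Theorems.KatoAssemblySocketAt
  Summit.BirchSwinnertonDyer.BirchSwinnertonDyer.Theorems.TwistDegreeStepFiveSevenOfSL2NeronValues
  Summit.BirchSwinnertonDyer.BirchSwinnertonDyer.Theorems.ManinFrameResidueProperRTameTwistAt
  Summit.BirchSwinnertonDyer.BirchSwinnertonDyer.Theorems.ManinFrameResidueProperRTameTwist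
  Summit.BirchSwinnertonDyer.BirchSwinnertonDyer.Theorems.TwistDegreeStepFiveSeven
  Summit.BirchSwinnertonDyer.BirchSwinnertonDyer.Theorems.TwistDegreeStepFiveSevenOffKPOfReciprocityLaw
  Summit.BirchSwinnertonDyer.BirchSwinnertonDyer.Theorems.StarredOptimalManinUnitFiveSevenCellsOfSL2NeronValues
  Summit.BirchSwinnertonDyer.BirchSwinnertonDyer.Theorems.StarredOptimalManinUnitFiveSevenSupersingularCellsExplicit
  Summit.BirchSwinnertonDyer.BirchSwinnertonDyer.Theorems.StarredOptimalManinUnitFiveSevenSupersingularCellsModels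
  CongruenceSubgroup Complex

namespace Summit.BirchSwinnertonDyer.BirchSwinnertonDyer.Theorems.TwistDegreeStepFiveSevenSupersingularCellFiveIV

/-! ### The bridge `ℚ_v ← K'_{v'}`, fed with the inequality-form capstone -/

section Bridge

variable (W : WeierstrassCurve ℚ) [W.IsElliptic] [W.IsGloballyMinimal] (p : ℕ) [hp : Fact p.Prime]

/-- **hDR at `ℚ_v` from the explicit `𝒪_D`-model, inequality-form cells** — `isDeRham_adicCompletion_rat_of_model_of_explicitCapstone`
verbatim with the capstone `isDeRham_restrictedRationalTateRep_of_explicitModel_of_lt` in place of the enumerated `hR'`: for `W/ℚ` globally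
minimal with `ord_p j ≥ 0`, numerology `e m = 4k + r₄`, `e n = 6k + r₆`, `3r₄ = e t₄`, `2r₆ = e t₆`, `3m = ord_p Δ + t₄`, `2n = ord_p Δ + t₆`,
`t₄ ≤ 2`, `t₆ ≤ 1`, the (N1′) inequalities, and a number field `K' ∋ α`, `α^e = p`, the representation `V_pW|_{Γ_{ℚ_v}}` is de Rham.
[cite: SilvermanAEC2009, VII.5.5 and IV.7.5] [cite: Fontaine1982FormesDifferentielles, §5] [cite: BrinonConrad2009, Prop. 6.3.8] -/
theorem isDeRham_adicCompletion_rat_of_model_of_lt (hp57 : p = 5 ∨ p = 7) (hj : 0 ≤ padicValRat p W.j)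
    {e k m n r₄ r₆ t₄ t₆ : ℕ} (he : 0 < e) (hem : e * m = 4 * k + r₄) (hen : e * n = 6 * k + r₆)
    (h₄ : 3 * r₄ = e * t₄) (h₆ : 2 * r₆ = e * t₆)
    (hm : 3 * m = padicValInt p W.minimalDiscriminantInt + t₄) (hn : 2 * n = padicValInt p W.minimalDiscriminantInt + t₆)
    (ht₄ : t₄ ≤ 2) (ht₆ : t₆ ≤ 1)
    (h5 : p = 5 → 0 < r₄ ∧ e < 9 ∧ e < r₄ + 4) (h7 : p = 7 → 0 < r₆ ∧ e < 13 ∧ e < r₆ + 6)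
    {K' : Type} [Field K'] [NumberField K'] {α : K'} (hαe : α ^ e = (p : K'))
    (v' : HeightOneSpectrum (𝓞 K')) (hv' : (p : 𝓞 K') ∈ v'.asIdeal)
    (v : HeightOneSpectrum (𝓞 ℚ)) (hpv : (p : 𝓞 ℚ) ∈ v.asIdeal)
    [CharZero (v.adicCompletion ℚ)] [Fact (¬ IsUnit (p : integerC (v.adicCompletion ℚ)))]
    [IsAdicComplete (Ideal.span {(p : integerC (v.adicCompletion ℚ))}) (integerC (v.adicCompletion ℚ))]
    (hp' : valuation (v.adicCompletion ℚ) p < 1) [Algebra ℚ_[p] (v.adicCompletion ℚ)] :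
    GaloisRep.IsDeRham (bdRPeriodRingData (F := v.adicCompletion ℚ) (p := p) hp')
      (restrictedRationalTateRep W (v.adicCompletion ℚ) p) := by
  have hpr : p.Prime := hp.out
  have hp5 : 5 ≤ p := by rcases hp57 with rfl | rfl <;> norm_num
  set V := integralModelInt W with hV
  set vΔ := padicValInt p W.minimalDiscriminantInt with hvΔ
  obtain ⟨A, hA⟩ := pow_dvd_c₄_of_padicValRat_j_nonneg W p hj (m := m) (by omega)
  obtain ⟨B, hB⟩ := pow_dvd_c₆_of_padicValRat_j_nonneg W p hj (n := n) (by omega)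
  have hΔ0 : V.Δ ≠ 0 := minimalDiscriminantInt_ne_zero W
  obtain ⟨d, hd⟩ : (p : ℤ) ^ vΔ ∣ V.Δ := (padicValInt_dvd_iff _ _).2 (Or.inr le_rfl)
  have hpd : ¬ (p : ℤ) ∣ d := by
    rintro ⟨d', rfl⟩
    have : (p : ℤ) ^ (vΔ + 1) ∣ V.Δ := ⟨d', by rw [hd, pow_succ]; ring⟩
    rcases (padicValInt_dvd_iff _ _).1 this with h | h
    · exact hΔ0 h
    · have h' : vΔ + 1 ≤ vΔ := h
      omega
  have hunit : IsUnit (64 * (-27 * (A : ℤ_[p])) ^ 3 * (p : ℤ_[p]) ^ t₄ + 432 * (-54 * (B : ℤ_[p])) ^ 2 * (p : ℤ_[p]) ^ t₆) := by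
    have hid := unit_identity (q := (p : ℤ)) (by exact_mod_cast hpr.ne_zero) hA.symm hB.symm hd.symm V.c_relation hm hn
    have hz : ¬ (p : ℤ) ∣ -(6 ^ 12 * d) := by
      rw [dvd_neg]
      intro h
      rcases (Nat.prime_iff_prime_int.mp hpr).dvd_or_dvd h with h6 | h6
      · have hp6 : (p : ℤ) ∣ 6 := Int.Prime.dvd_pow' hpr h6
        rcases hp57 with rfl | rfl <;> norm_num at hp6
      · exact hpd h6
    have hu : IsUnit (((-(6 ^ 12 * d) : ℤ)) : ℤ_[p]) := by
      rw [PadicInt.isUnit_iff]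
      exact le_antisymm (PadicInt.norm_le_one _) (not_lt.1 fun h => hz ((PadicInt.norm_int_lt_one_iff_dvd _).1 h))
    rw [← hid] at hu
    push_cast at hu
    exact hu
  have hα0 : α ≠ 0 := by
    intro h0; rw [h0, zero_pow he.ne'] at hαe; exact (Nat.cast_ne_zero.2 hpr.ne_zero) hαe.symm
  -- the `K'`-model `S ≅ W ×_ℚ K'`
  set S : WeierstrassCurve K' :=
    ⟨0, 0, 0, -27 * (V.c₄ : K') / (α ^ k) ^ 4, -54 * (V.c₆ : K') / (α ^ k) ^ 6⟩ with hS
  have hWK' : W.baseChange K' = V.map (Int.castRingHom K') := by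
    rw [WeierstrassCurve.baseChange, ← map_integralModelInt W, WeierstrassCurve.map_map]
    congr 1
    exact RingHom.ext_int _ _
  have hc4K : (W.baseChange K').c₄ = (V.c₄ : K') := by rw [hWK', WeierstrassCurve.map_c₄, eq_intCast]
  have hc6K : (W.baseChange K').c₆ = (V.c₆ : K') := by rw [hWK', WeierstrassCurve.map_c₆, eq_intCast]
  have h6 : (6 : K') ≠ 0 := by norm_num
  obtain ⟨C, hC⟩ := exists_variableChange_eq_short (L := K') two_ne_zero three_ne_zero (W.baseChange K')
    (u := α ^ k / 6) (div_ne_zero (pow_ne_zero _ hα0) h6)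
  have e4 : -(V.c₄ : K') / (48 * (α ^ k / 6) ^ 4) = -27 * (V.c₄ : K') / (α ^ k) ^ 4 := by
    have : (α ^ k) ≠ 0 := pow_ne_zero _ hα0
    field_simp
    ring
  have e6 : -(V.c₆ : K') / (864 * (α ^ k / 6) ^ 6) = -54 * (V.c₆ : K') / (α ^ k) ^ 6 := by
    have : (α ^ k) ≠ 0 := pow_ne_zero _ hα0
    field_simp
    ring
  have hC' : C • W.baseChange K' = S := by rw [hC, hS, hc4K, hc6K, e4, e6]
  haveI : S.IsElliptic := hC' ▸ (inferInstance : (C • W.baseChange K').IsElliptic)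
  have hiso : IsIsogenous (W.baseChange K') S := isIsogenous_of_smul_eq hC'
  refine isDeRham_restrictedRationalTateRep_adicCompletion_rat_of_isDeRham_isogenous_above W v' hv' S hiso ?_ v hpv hp'
  -- hDR for `S` at `F = K'_{v'}` from the capstone
  intro _ _ _ hpF _
  obtain ⟨ϖ, hϖ⟩ : ∃ ϖ : v'.adicCompletion K', ϖ = algebraMap K' (v'.adicCompletion K') α := ⟨_, rfl⟩
  have hϖe : ϖ ^ e = (p : v'.adicCompletion K') := by rw [hϖ, ← map_pow, hαe, map_natCast]
  have hϖ0 : ϖ ≠ 0 := by rw [hϖ]; exact (_root_.map_ne_zero _).2 hα0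
  obtain ⟨D, hDpoly, hDroot⟩ := EisensteinRoot.exists_poly_eq_X_pow_sub_C hpF he hϖe
  have hroot := D.root_pow_eq_of_poly_eq hDpoly
  have hunit' : IsUnit (64 * (((-27 * A : ℤ) : ℤ_[p])) ^ 3 * (p : ℤ_[p]) ^ t₄ +
      432 * (((-54 * B : ℤ) : ℤ_[p])) ^ 2 * (p : ℤ_[p]) ^ t₆) := by
    push_cast
    exact hunit
  refine isDeRham_restrictedRationalTateRep_of_explicitModel_of_lt hpF D hDpoly S ((-27 * A : ℤ) : ℤ_[p]) ((-54 * B : ℤ) : ℤ_[p])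
    r₄ r₆ t₄ t₆ hp57 h5 h7 h₄ h₆ hunit' ?_
  -- `S ×_{K'} F = W_D ⊗ F`
  rw [map_model_toF, hDroot]
  have hp4 : (ϖ ^ k) ^ 4 * ϖ ^ r₄ = (p : v'.adicCompletion K') ^ m := by
    rw [← pow_mul, ← pow_add, show k * 4 + r₄ = e * m by omega, pow_mul, hϖe]
  have hp6 : (ϖ ^ k) ^ 6 * ϖ ^ r₆ = (p : v'.adicCompletion K') ^ n := by
    rw [← pow_mul, ← pow_add, show k * 6 + r₆ = e * n by omega, pow_mul, hϖe]
  have hc4F : ((V.c₄ : ℤ) : v'.adicCompletion K') = (ϖ ^ k) ^ 4 * ϖ ^ r₄ * (A : v'.adicCompletion K') := by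
    rw [hp4, hA]; push_cast; ring
  have hc6F : ((V.c₆ : ℤ) : v'.adicCompletion K') = (ϖ ^ k) ^ 6 * ϖ ^ r₆ * (B : v'.adicCompletion K') := by
    rw [hp6, hB]; push_cast; ring
  have hϖk : ϖ ^ k ≠ 0 := pow_ne_zero _ hϖ0
  have ha4 : algebraMap K' (v'.adicCompletion K') (-27 * (V.c₄ : K') / (α ^ k) ^ 4) =
      zpToF hpF ((-27 * A : ℤ) : ℤ_[p]) * ϖ ^ r₄ := by
    rw [map_div₀, map_mul, map_neg, map_ofNat, map_intCast, map_pow, map_pow, ← hϖ, map_intCast, hc4F]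
    field_simp
    push_cast
    ring
  have ha6 : algebraMap K' (v'.adicCompletion K') (-54 * (V.c₆ : K') / (α ^ k) ^ 6) =
      zpToF hpF ((-54 * B : ℤ) : ℤ_[p]) * ϖ ^ r₆ := by
    rw [map_div₀, map_mul, map_neg, map_ofNat, map_intCast, map_pow, map_pow, ← hϖ, map_intCast, hc6F]
    field_simp
    push_cast
    ring
  exact WeierstrassCurve.ext (map_zero _) (map_zero _) (map_zero _) ha4 ha6

end Bridge

/-! ### The cell `(5; IV)` -/

variable {p : ℕ} [hp : Fact p.Prime]

/-- ★ **`V_pV|_{Γ_{ℚ_v}}` is de Rham for an additive fibre of Kodaira type IV at `5`** (`ord₅ Δ_min = 4`, no `Iₙ*`): cell data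
`(e, k, m, n, r₄, r₆, t₄, t₆) = (3, 1, 2, 2, 2, 0, 2, 0)` over `K' = ℚ(5^{1/3})` (good supersingular model `y² = x³ + a ϱ² x + b`), (N1′)
inequality `3 < 2 + 4`. [cite: SilvermanAEC2009, VII.5.5 and IV.7.5] [cite: Fontaine1982FormesDifferentielles, §5] -/
theorem isDeRham_adicCompletion_rat_five_of_padicValInt_eq_four
    (V : WeierstrassCurve ℚ) [V.IsElliptic] [V.IsGloballyMinimal] (hp5 : p = 5) (hadd : Addv V p)
    (hK : ∀ (v : HeightOneSpectrum ℤ) (n : ℕ), natGenerator v = p → V.kodairaSymbolAt v ≠ KodairaSymbol.Istar n)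
    (h4 : padicValInt p V.minimalDiscriminantInt = 4)
    (v : HeightOneSpectrum (𝓞 ℚ)) (hpv : ((p : ℕ) : 𝓞 ℚ) ∈ v.asIdeal)
    [CharZero (v.adicCompletion ℚ)] [Fact (¬ IsUnit (p : integerC (v.adicCompletion ℚ)))]
    [IsAdicComplete (Ideal.span {(p : integerC (v.adicCompletion ℚ))}) (integerC (v.adicCompletion ℚ))]
    (hp' : valuation (v.adicCompletion ℚ) p < 1) [Algebra ℚ_[p] (v.adicCompletion ℚ)] :
    GaloisRep.IsDeRham (bdRPeriodRingData (F := v.adicCompletion ℚ) (p := p) hp')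
      (restrictedRationalTateRep V (v.adicCompletion ℚ) p) := by
  have hj : 0 ≤ padicValRat p V.j :=
    MemberManinUnitFiveSevenGlue.padicValRat_j_nonneg_of_forall_ne_Istar V (by omega) hadd hK
  subst hp5
  obtain ⟨K', _, _, α, v', hαe, hv'⟩ := exists_numberField_pow_eq_prime (e := 3) (by norm_num) hp.out
  exact isDeRham_adicCompletion_rat_of_model_of_lt V 5 (Or.inl rfl) hj (e := 3) (k := 1) (m := 2) (n := 2) (r₄ := 2) (r₆ := 0)
    (t₄ := 2) (t₆ := 0) (by norm_num) (by norm_num) (by norm_num) (by norm_num) (by norm_num) (by rw [h4]) (by rw [h4])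
    (by norm_num) (by norm_num) (fun _ => by norm_num) (fun h => by norm_num at h) hαe v' hv' v hpv hp'

/-- ★★ **Cell `(5; IV)` of TDS57 GRANTED {P1-bar, hT₂, modularity, Dokchitser–Dokchitser 5.1 (1)}** — the conclusion of TDS57 at
`(5, V, W♭)` for `ord₅ Δ_min(V) = 4`: de Rham by `isDeRham_adicCompletion_rat_five_of_padicValInt_eq_four`, off-KP by
`forall_member_noTorsion_of_kodaira_IV_or_III_at_seven`. CONDITIONAL; nothing closed.
[cite: Kato2004Asterisque, (8.1.3) (p. 180), Thm. 9.7 (p. 189)] [cite: DokchitserDokchitser2015LocalInvariants, Thm. 5.1 (1)]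
[cite: Fontaine1982FormesDifferentielles, §5] -/
theorem twistDegreeStep57_of_sl2NeronValuesBar_five_of_padicValInt_eq_four
    (hT₂ : exists_smul_range_expStarCoord_tower_iff_trace_log) (hP1 : exists_member_sl2ZetaElement_neron_values_bar)
    (hnf : exists_isNewformOf) (hDD : dokchitser_padicValInt_minimalDiscriminantInt_eq_of_isogeny_of_not_dvd_degree)
    (V : WeierstrassCurve ℚ) [V.IsElliptic] [V.IsGloballyMinimal] [NeZero (V.conductorNorm ℤ)]
    (Wf : WeierstrassCurve ℚ) [Wf.IsElliptic] [Wf.IsGloballyMinimal] [NeZero (Wf.conductorNorm ℤ)]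
    (C : VariableChange ℚ) (hp5 : p = 5) (hadd : Addv V p) (hirr : Irr V p)
    (hK : ∀ (v : HeightOneSpectrum ℤ) (n : ℕ), natGenerator v = p → V.kodairaSymbolAt v ≠ KodairaSymbol.Istar n)
    (h4 : padicValInt p V.minimalDiscriminantInt = 4)
    (hC : C • V.quadraticTwist ((-1 : ℚ) ^ (p / 2) * p) = Wf) :
    ∃ D : ModularParametrizationData V (V.conductorNorm ℤ),
      ∀ Df : ModularParametrizationData Wf (Wf.conductorNorm ℤ),
        padicValNat p D.modularDegree < padicValNat p Df.modularDegree := by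
  have hj : 0 ≤ padicValRat p V.j :=
    MemberManinUnitFiveSevenGlue.padicValRat_j_nonneg_of_forall_ne_Istar V (by omega) hadd hK
  exact twistDegreeStep57_of_sl2NeronValuesBar_of_noTorsion_of_isDeRhamAt hT₂ hP1 hnf V Wf C (Or.inl hp5) hadd hirr hK (by omega) hC
    (forall_member_noTorsion_of_kodaira_IV_or_III_at_seven hDD V (by omega) hadd hirr hj (Or.inl h4))
    (fun v hpv _ _ _ hp' _ ↦ isDeRham_adicCompletion_rat_five_of_padicValInt_eq_four V hp5 hadd hK h4 v hpv hp')

/-- **At `p = 5`, `ord₅ Δ_min ∈ {3, 4}` (types III, IV), off the KP sub-residue, GRANTED {P1-bar, hT₂, modularity}** — no de Rham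
hypothesis: `(5; III)` is (G)-ordinary (`typeGOrd_five_of_padicValInt_eq_three`), `(5; IV)` by the explicit supersingular model.
[cite: Kato2004Asterisque, (8.1.3) (p. 180), Thm. 9.7 (p. 189)] [cite: DokchitserDokchitser2015LocalInvariants, Thm. 3.2]
[cite: Fontaine1982FormesDifferentielles, §5] -/
theorem twistDegreeStep57_of_sl2NeronValuesBar_of_noTorsion_five_of_three_le
    (hT₂ : exists_smul_range_expStarCoord_tower_iff_trace_log) (hP1 : exists_member_sl2ZetaElement_neron_values_bar)
    (hnf : exists_isNewformOf)
    (V : WeierstrassCurve ℚ) [V.IsElliptic] [V.IsGloballyMinimal] [NeZero (V.conductorNorm ℤ)]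
    (Wf : WeierstrassCurve ℚ) [Wf.IsElliptic] [Wf.IsGloballyMinimal] [NeZero (Wf.conductorNorm ℤ)]
    (C : VariableChange ℚ) (hp5 : p = 5) (hadd : Addv V p) (hirr : Irr V p)
    (hK : ∀ (v : HeightOneSpectrum ℤ) (n : ℕ), natGenerator v = p → V.kodairaSymbolAt v ≠ KodairaSymbol.Istar n)
    (h3 : 3 ≤ padicValInt p V.minimalDiscriminantInt) (hV4 : padicValInt p V.minimalDiscriminantInt ≤ 4)
    (hC : C • V.quadraticTwist ((-1 : ℚ) ^ (p / 2) * p) = Wf)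
    (hPT : ∀ (W' : WeierstrassCurve ℚ) [W'.IsElliptic] [W'.IsGloballyMinimal], IsIsogenous V W' →
      ∀ P : (W'.baseChange ℚ_[p]).toAffine.Point, p • P = 0 → P = 0) :
    ∃ D : ModularParametrizationData V (V.conductorNorm ℤ),
      ∀ Df : ModularParametrizationData Wf (Wf.conductorNorm ℤ),
        padicValNat p D.modularDegree < padicValNat p Df.modularDegree := by
  by_cases h4 : padicValInt p V.minimalDiscriminantInt = 4
  · exact twistDegreeStep57_of_sl2NeronValuesBar_of_noTorsion_of_isDeRhamAt hT₂ hP1 hnf V Wf C (Or.inl hp5) hadd hirr hK hV4 hC hPT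
      (fun v hpv _ _ _ hp' _ ↦ isDeRham_adicCompletion_rat_five_of_padicValInt_eq_four V hp5 hadd hK h4 v hpv hp')
  · exact twistDegreeStep57_of_sl2NeronValuesBar_of_noTorsion_five_of_padicValInt_eq_three hT₂ hP1 hnf V Wf C hp5 hadd hirr hK
      (by omega) hC hPT

/-- ★★ **Cell `(5; IV)` GRANTED {[REC-tower], P1-bar, modularity, DD 5.1 (1)}** (hT₂ := `…_of_reciprocityLaw`, p700964).
[cite: Kato1993LNM1553, Ch. II Thm. 1.4.1 (4)] [cite: Kato2004Asterisque, (8.1.3) (p. 180), Thm. 9.7 (p. 189)]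
[cite: DokchitserDokchitser2015LocalInvariants, Thm. 5.1 (1)] -/
theorem twistDegreeStep57_of_reciprocityLaw_of_sl2NeronValuesBar_five_of_padicValInt_eq_four
    (hrec : tatePairingPoint_eq_trace_expStar_log_tower) (hP1 : exists_member_sl2ZetaElement_neron_values_bar)
    (hnf : exists_isNewformOf) (hDD : dokchitser_padicValInt_minimalDiscriminantInt_eq_of_isogeny_of_not_dvd_degree)
    (V : WeierstrassCurve ℚ) [V.IsElliptic] [V.IsGloballyMinimal] [NeZero (V.conductorNorm ℤ)]
    (Wf : WeierstrassCurve ℚ) [Wf.IsElliptic] [Wf.IsGloballyMinimal] [NeZero (Wf.conductorNorm ℤ)]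
    (C : VariableChange ℚ) (hp5 : p = 5) (hadd : Addv V p) (hirr : Irr V p)
    (hK : ∀ (v : HeightOneSpectrum ℤ) (n : ℕ), natGenerator v = p → V.kodairaSymbolAt v ≠ KodairaSymbol.Istar n)
    (h4 : padicValInt p V.minimalDiscriminantInt = 4)
    (hC : C • V.quadraticTwist ((-1 : ℚ) ^ (p / 2) * p) = Wf) :
    ∃ D : ModularParametrizationData V (V.conductorNorm ℤ),
      ∀ Df : ModularParametrizationData Wf (Wf.conductorNorm ℤ),
        padicValNat p D.modularDegree < padicValNat p Df.modularDegree :=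
  twistDegreeStep57_of_sl2NeronValuesBar_five_of_padicValInt_eq_four
    (exists_smul_range_expStarCoord_tower_iff_trace_log_of_reciprocityLaw hrec) hP1 hnf hDD V Wf C hp5 hadd hirr hK h4 hC

end Summit.BirchSwinnertonDyer.BirchSwinnertonDyer.Theorems.TwistDegreeStepFiveSevenSupersingularCellFiveIV

end
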